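import Literature.RepresentationTheory.KonnoKonno2007.RealUnitaryKAK
import HarnessLib

/-!
# The `KAK` word of the dual pair `U(P,Q) × U(R,S)` with a compact second factor — every real rank, and the rank-two currency

Topic `RepresentationTheory/KonnoKonno2007`; namespace `Literature.RepresentationTheory.KonnoKonno2007.RealDualPair`.
KERNEL ONLY: 0 definitions, 0 records, 0 `Prop`-valued definitions, 0 hypotheses of print; every statement is a kernel
fact about the explicit matrix groups of `RealUnitaryDualPair` / `RealUnitaryRankOneKAK` / `RealUnitaryKAK`; public
statements are forms of the Cartan decomposition `G = K A K` of `U(p,q)` [Knapp2002, VII §3 Thm. 7.39] and carry that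
locator.  The words are written as lambdas throughout (no definition is introduced), in the exact shape of the fields
`isProperMap_word` / `word_surjective` of `Literature.NumberTheory.Weil1964.LeviKAKInput`
(`fun p => κ p.1 * a p.2.1 * κ p.2.2`).

★ `RealUnitaryKAK` proves the Cartan decomposition of `G = U(α,β)` at EVERY real rank: for a frame of pairwise disjoint
hyperbolic planes `(p j, q j)`, `j ∈ ι` (`p`, `q` injective, one of them onto), the word
`kakMapA hp hq : K × ℝ^ι × K → U(α,β)`, `(k₁, t, k₂) ↦ k₁ · a_t · k₂` (`a_t = hypA hp hq univ t = ∏_j hypV (p j) (q j) (t j)`)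
is continuous, PROPER (`isProperMap_kakMapA`) and ONTO (`kakMapA_surjective`).  ★ `RealUnitaryRankOneKAK` §10 turns the
rank-one word into the word of the PAIR `G_∞ = U(P,Q) × U(R,S)` whose second factor is its own maximal compact
(`kV R S` onto — a definite `W`): `kakMapPair = kakMap × kMulW ∘ shuffle`.  This file does the same at every rank, and
then specialises to the rank-TWO currency of two named planes `(p₀,q₀)`, `(p₁,q₁)` and a parameter `t ∈ ℝ × ℝ`:

* §1 (any `ι`) the pair word `x ↦ κ x.1 · (a_{x.2.1}, 1) · κ x.2.2 : (K × K′) × ℝ^ι × (K × K′) → U(P,Q) × U(R,S)` is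
  continuous and PROPER with no hypothesis on `W` (`isProperMap_kakWordPairA`), ONTO and a quotient map (also after
  `× id_X`) when `p` or `q` is onto and `kV R S` is onto (`kakWordPairA_surjective`, `isQuotientMap_kakWordPairA(_prodMap)`);
* §2 (two planes, `t : ℝ × ℝ`) the same for the word `x ↦ κ x.1 · (hypV p₀ q₀ t₁ · hypV p₁ q₁ t₂, 1) · κ x.2.2`
  (`p₀ ≠ p₁`, `q₀ ≠ q₁`; onto when `{p₀,p₁} = P` or `{q₀,q₁} = Q`): `isProperMap_kakWordPairTwo`,
  `kakWordPairTwo_surjective`, `isQuotientMap_kakWordPairTwo(_prodMap)`, via `ι := Fin 2` and `ℝ × ℝ ≃ₜ ℝ^{Fin 2}`;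
  and the `U(2,2)` instance `isProperMap_and_surjective_kakWordPairTwo_fin_two` (`P = Q = Fin 2`, planes `(0,0)`,
  `(1,1)`) — the two `LeviKAKInput` fields at a real place of signature `(2,2)` (consumer: `LeviKAKInput.rankTwo`,
  the archimedean theta majorants of the doubled pair `(U(2,2), U(1))`).

References: [Knapp2002] A. W. Knapp, *Lie Groups Beyond an Introduction*, 2nd ed., Birkhäuser 2002, VII §3 Thm. 7.39;
[KonnoKonno2007] K. Konno, T. Konno, Kyushu J. Math. 61 (2007) §3.1; [MoeglinVignerasWaldspurger1987] Ch. 1 I.17.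
-/

set_option autoImplicit false

noncomputable section

open Matrix Complex Topology Filter
open scoped ComplexConjugate

namespace Literature.RepresentationTheory.KonnoKonno2007

namespace RealDualPair

open Literature.NumberTheory.Automorphic Literature.NumberTheory.Automorphic.UnitaryGroup
open Literature.Analysis.SegalBargmann

/-! ## 1. The pair word at arbitrary real rank -/

section PairA

variable {ι P Q R S : Type*} [Fintype P] [DecidableEq P] [Fintype Q] [DecidableEq Q] [Fintype R] [DecidableEq R]
  [Fintype S] [DecidableEq S] [Fintype ι] {p : ι → P} {q : ι → Q}
  (hp : Function.Injective p) (hq : Function.Injective q)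

/-- the pair word is `kakMapA × kMulW` after the coordinate shuffle `((k₁,k₂), t, (k₁',k₂')) ↦ ((k₁,t,k₁'), (k₂,k₂'))`,
a homeomorphism. [folklore] -/
private theorem kakWordPairA_eq :
    ∃ e : DPK P Q R S × (ι → ℝ) × DPK P Q R S ≃ₜ (KV P Q × (ι → ℝ) × KV P Q) × (KV R S × KV R S),
      (fun x : DPK P Q R S × (ι → ℝ) × DPK P Q R S =>
          κ P Q R S x.1 * ((hypA hp hq Finset.univ x.2.1 : UForm P Q), (1 : UForm R S)) * κ P Q R S x.2.2) =
        Prod.map (kakMapA hp hq) kMulW ∘ e :=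
  ⟨{ toFun := fun x => ((x.1.1, x.2.1, x.2.2.1), (x.1.2, x.2.2.2))
     invFun := fun y => ((y.1.1, y.2.1), y.1.2.1, (y.1.2.2, y.2.2))
     left_inv := fun _ => rfl
     right_inv := fun _ => rfl
     continuous_toFun := by fun_prop
     continuous_invFun := by fun_prop }, rfl⟩

/-- **the pair word is continuous** (any rank). [cite: Knapp2002, VII §3 Thm. 7.39] -/
theorem continuous_kakWordPairA :
    Continuous fun x : DPK P Q R S × (ι → ℝ) × DPK P Q R S =>
      κ P Q R S x.1 * ((hypA hp hq Finset.univ x.2.1 : UForm P Q), (1 : UForm R S)) * κ P Q R S x.2.2 := by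
  obtain ⟨e, he⟩ := kakWordPairA_eq (R := R) (S := S) hp hq
  rw [he]
  exact ((continuous_kakMapA hp hq).prodMap continuous_kMulW).comp e.continuous

/-- **the pair word is a proper map** (any rank; no hypothesis on the `W`-factor): `kakMapA` is proper
(★ `isProperMap_kakMapA`) and `K′ × K′ → U(R,S)` has compact source. [cite: Knapp2002, VII §3 Thm. 7.39] -/
theorem isProperMap_kakWordPairA :
    IsProperMap fun x : DPK P Q R S × (ι → ℝ) × DPK P Q R S =>
      κ P Q R S x.1 * ((hypA hp hq Finset.univ x.2.1 : UForm P Q), (1 : UForm R S)) * κ P Q R S x.2.2 := by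
  obtain ⟨e, he⟩ := kakWordPairA_eq (R := R) (S := S) hp hq
  rw [he]
  exact ((isProperMap_kakMapA hp hq).prodMap isProperMap_kMulW).comp e.isProperMap

/-- **the pair word is onto** when the planes exhaust `P` or `Q` (`p` or `q` onto) and `K′ = U(R) × U(S) ↠ U(R,S)`
(a definite `W`). [cite: Knapp2002, VII §3 Thm. 7.39] -/
theorem kakWordPairA_surjective (hpq : Function.Surjective p ∨ Function.Surjective q)
    (hW : Function.Surjective (UForm.kV R S)) :
    Function.Surjective fun x : DPK P Q R S × (ι → ℝ) × DPK P Q R S =>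
      κ P Q R S x.1 * ((hypA hp hq Finset.univ x.2.1 : UForm P Q), (1 : UForm R S)) * κ P Q R S x.2.2 := by
  obtain ⟨e, he⟩ := kakWordPairA_eq (R := R) (S := S) hp hq
  rw [he]
  exact ((kakMapA_surjective hp hq hpq).prodMap (kMulW_surjective hW)).comp e.surjective

/-- **the pair word is a quotient map** (planes exhausting `P` or `Q`, `K′ ↠ U(R,S)`). [cite: Knapp2002, VII §3 Thm. 7.39] -/
theorem isQuotientMap_kakWordPairA (hpq : Function.Surjective p ∨ Function.Surjective q)
    (hW : Function.Surjective (UForm.kV R S)) :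
    Topology.IsQuotientMap fun x : DPK P Q R S × (ι → ℝ) × DPK P Q R S =>
      κ P Q R S x.1 * ((hypA hp hq Finset.univ x.2.1 : UForm P Q), (1 : UForm R S)) * κ P Q R S x.2.2 :=
  (isProperMap_kakWordPairA hp hq).isClosedMap.isQuotientMap (continuous_kakWordPairA hp hq)
    (kakWordPairA_surjective hp hq hpq hW)

/-- **the pair word `× id_X` is a quotient map** for every space `X` (planes exhausting `P` or `Q`, `K′ ↠ U(R,S)`):
joint continuity with a parameter descends along the word. [cite: Knapp2002, VII §3 Thm. 7.39] -/
theorem isQuotientMap_kakWordPairA_prodMap (hpq : Function.Surjective p ∨ Function.Surjective q)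
    (hW : Function.Surjective (UForm.kV R S)) (X : Type*) [TopologicalSpace X] :
    Topology.IsQuotientMap (Prod.map
      (fun x : DPK P Q R S × (ι → ℝ) × DPK P Q R S =>
        κ P Q R S x.1 * ((hypA hp hq Finset.univ x.2.1 : UForm P Q), (1 : UForm R S)) * κ P Q R S x.2.2)
      (id : X → X)) :=
  ((isProperMap_kakWordPairA hp hq).prodMap isProperMap_id).isClosedMap.isQuotientMap
    ((continuous_kakWordPairA hp hq).prodMap continuous_id)
    ((kakWordPairA_surjective hp hq hpq hW).prodMap Function.surjective_id)

end PairA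

/-! ## 2. Real rank two in the currency of two named planes and `t ∈ ℝ × ℝ` -/

section PairTwo

variable {P Q R S : Type*} [Fintype P] [DecidableEq P] [Fintype Q] [DecidableEq Q] [Fintype R] [DecidableEq R]
  [Fintype S] [DecidableEq S]

/-- `![a, b]` is injective when `a ≠ b`. [folklore] -/
private theorem injective_vecTwo {X : Type*} {a b : X} (h : a ≠ b) : Function.Injective ![a, b] := by
  intro i j hij
  fin_cases i <;> fin_cases j
  · rfl
  · exact absurd (by simpa using hij) h
  · exact absurd (by simpa using hij.symm) h
  · rfl

/-- `![a, b]` is onto when every element is `a` or `b`. [folklore] -/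
private theorem surjective_vecTwo {X : Type*} {a b : X} (h : ∀ x, x = a ∨ x = b) : Function.Surjective ![a, b] := by
  intro x
  rcases h x with rfl | rfl
  · exact ⟨0, rfl⟩
  · exact ⟨1, rfl⟩

variable (p₀ p₁ : P) (q₀ q₁ : Q)

/-- the two-plane torus is the `Fin 2`-indexed `hypA`: `hypA univ t = hypV p₀ q₀ (t 0) · hypV p₁ q₁ (t 1)`. [folklore] -/
private theorem hypA_fin_two (hp : p₀ ≠ p₁) (hq : q₀ ≠ q₁) (t : Fin 2 → ℝ) :
    (hypA (injective_vecTwo hp) (injective_vecTwo hq) Finset.univ t : UForm P Q) =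
      hypV p₀ q₀ (t 0) * hypV p₁ q₁ (t 1) := by
  have hu : (Finset.univ : Finset (Fin 2)) = insert 0 {1} := by decide
  rw [hu, hypA_insert _ _ (show (0 : Fin 2) ∉ ({1} : Finset (Fin 2)) by decide)]
  have h1 : (hypA (injective_vecTwo hp) (injective_vecTwo hq) ({1} : Finset (Fin 2)) t : UForm P Q) =
      hypV (![p₀, p₁] 1) (![q₀, q₁] 1) (t 1) :=
    Finset.noncommProd_singleton _ _
  rw [h1]
  rfl

/-- the two-plane pair word is the `Fin 2`-indexed pair word after `ℝ × ℝ ≃ₜ ℝ^{Fin 2}` in the middle factor. [folklore] -/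
private theorem kakWordPairTwo_eq (hp : p₀ ≠ p₁) (hq : q₀ ≠ q₁) :
    ∃ e : DPK P Q R S × (ℝ × ℝ) × DPK P Q R S ≃ₜ DPK P Q R S × (Fin 2 → ℝ) × DPK P Q R S,
      (fun x : DPK P Q R S × (ℝ × ℝ) × DPK P Q R S =>
          κ P Q R S x.1 * ((hypV p₀ q₀ x.2.1.1 * hypV p₁ q₁ x.2.1.2 : UForm P Q), (1 : UForm R S)) * κ P Q R S x.2.2) =
        (fun y : DPK P Q R S × (Fin 2 → ℝ) × DPK P Q R S =>
          κ P Q R S y.1 * ((hypA (injective_vecTwo hp) (injective_vecTwo hq) Finset.univ y.2.1 : UForm P Q),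
            (1 : UForm R S)) * κ P Q R S y.2.2) ∘ e := by
  refine ⟨{ toFun := fun x => (x.1, ![x.2.1.1, x.2.1.2], x.2.2)
            invFun := fun y => (y.1, (y.2.1 0, y.2.1 1), y.2.2)
            left_inv := fun x => rfl
            right_inv := fun y => ?_
            continuous_toFun := ?_
            continuous_invFun := by fun_prop }, funext fun x => ?_⟩
  · obtain ⟨k, t, k'⟩ := y
    simp only [Prod.mk.injEq, true_and, and_true]
    funext i
    fin_cases i <;> rfl
  · refine (continuous_fst.prodMk ((continuous_pi fun i => ?_).prodMk (continuous_snd.comp continuous_snd)))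
    fin_cases i <;> (simp; fun_prop)
  · simp only [Function.comp_apply, Homeomorph.homeomorph_mk_coe, Equiv.coe_fn_mk]
    rw [hypA_fin_two p₀ p₁ q₀ q₁ hp hq]
    rfl

/-- **the rank-two pair word is continuous** (`p₀ ≠ p₁`, `q₀ ≠ q₁`). [cite: Knapp2002, VII §3 Thm. 7.39] -/
theorem continuous_kakWordPairTwo (hp : p₀ ≠ p₁) (hq : q₀ ≠ q₁) :
    Continuous fun x : DPK P Q R S × (ℝ × ℝ) × DPK P Q R S =>
      κ P Q R S x.1 * ((hypV p₀ q₀ x.2.1.1 * hypV p₁ q₁ x.2.1.2 : UForm P Q), (1 : UForm R S)) * κ P Q R S x.2.2 := by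
  obtain ⟨e, he⟩ := kakWordPairTwo_eq (R := R) (S := S) p₀ p₁ q₀ q₁ hp hq
  rw [he]
  exact (continuous_kakWordPairA _ _).comp e.continuous

/-- **the rank-two pair word is a proper map** (`p₀ ≠ p₁`, `q₀ ≠ q₁`; no hypothesis on the `W`-factor) — the field
`LeviKAKInput.isProperMap_word` at a real place of signature `(p,2)`/`(2,q)`. [cite: Knapp2002, VII §3 Thm. 7.39] -/
theorem isProperMap_kakWordPairTwo (hp : p₀ ≠ p₁) (hq : q₀ ≠ q₁) :
    IsProperMap fun x : DPK P Q R S × (ℝ × ℝ) × DPK P Q R S =>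
      κ P Q R S x.1 * ((hypV p₀ q₀ x.2.1.1 * hypV p₁ q₁ x.2.1.2 : UForm P Q), (1 : UForm R S)) * κ P Q R S x.2.2 := by
  obtain ⟨e, he⟩ := kakWordPairTwo_eq (R := R) (S := S) p₀ p₁ q₀ q₁ hp hq
  rw [he]
  exact (isProperMap_kakWordPairA _ _).comp e.isProperMap

/-- **the rank-two pair word is onto** when the two planes exhaust `P` or `Q` (`P = {p₀,p₁}` or `Q = {q₀,q₁}`) and
`K′ ↠ U(R,S)` — the field `LeviKAKInput.word_surjective` at a real place of signature `(2,2)`, `(p,2)`, `(2,q)`.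
[cite: Knapp2002, VII §3 Thm. 7.39] -/
theorem kakWordPairTwo_surjective (hp : p₀ ≠ p₁) (hq : q₀ ≠ q₁)
    (hPQ : (∀ a : P, a = p₀ ∨ a = p₁) ∨ (∀ b : Q, b = q₀ ∨ b = q₁)) (hW : Function.Surjective (UForm.kV R S)) :
    Function.Surjective fun x : DPK P Q R S × (ℝ × ℝ) × DPK P Q R S =>
      κ P Q R S x.1 * ((hypV p₀ q₀ x.2.1.1 * hypV p₁ q₁ x.2.1.2 : UForm P Q), (1 : UForm R S)) * κ P Q R S x.2.2 := by
  obtain ⟨e, he⟩ := kakWordPairTwo_eq (R := R) (S := S) p₀ p₁ q₀ q₁ hp hq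
  rw [he]
  refine (kakWordPairA_surjective _ _ ?_ hW).comp e.surjective
  rcases hPQ with h | h
  · exact Or.inl (surjective_vecTwo h)
  · exact Or.inr (surjective_vecTwo h)

/-- **the rank-two pair word is a quotient map** (planes exhausting `P` or `Q`, `K′ ↠ U(R,S)`).
[cite: Knapp2002, VII §3 Thm. 7.39] -/
theorem isQuotientMap_kakWordPairTwo (hp : p₀ ≠ p₁) (hq : q₀ ≠ q₁)
    (hPQ : (∀ a : P, a = p₀ ∨ a = p₁) ∨ (∀ b : Q, b = q₀ ∨ b = q₁)) (hW : Function.Surjective (UForm.kV R S)) :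
    Topology.IsQuotientMap fun x : DPK P Q R S × (ℝ × ℝ) × DPK P Q R S =>
      κ P Q R S x.1 * ((hypV p₀ q₀ x.2.1.1 * hypV p₁ q₁ x.2.1.2 : UForm P Q), (1 : UForm R S)) * κ P Q R S x.2.2 :=
  (isProperMap_kakWordPairTwo p₀ p₁ q₀ q₁ hp hq).isClosedMap.isQuotientMap (continuous_kakWordPairTwo p₀ p₁ q₀ q₁ hp hq)
    (kakWordPairTwo_surjective p₀ p₁ q₀ q₁ hp hq hPQ hW)

/-- **the rank-two pair word `× id_X` is a quotient map** for every space `X`: joint continuity with a parameter on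
`U(P,Q) × U(R,S)` is continuity in `((k₁,k₂), (t₁,t₂), (k₁',k₂'), x)`. [cite: Knapp2002, VII §3 Thm. 7.39] -/
theorem isQuotientMap_kakWordPairTwo_prodMap (hp : p₀ ≠ p₁) (hq : q₀ ≠ q₁)
    (hPQ : (∀ a : P, a = p₀ ∨ a = p₁) ∨ (∀ b : Q, b = q₀ ∨ b = q₁)) (hW : Function.Surjective (UForm.kV R S))
    (X : Type*) [TopologicalSpace X] :
    Topology.IsQuotientMap (Prod.map
      (fun x : DPK P Q R S × (ℝ × ℝ) × DPK P Q R S =>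
        κ P Q R S x.1 * ((hypV p₀ q₀ x.2.1.1 * hypV p₁ q₁ x.2.1.2 : UForm P Q), (1 : UForm R S)) * κ P Q R S x.2.2)
      (id : X → X)) :=
  ((isProperMap_kakWordPairTwo p₀ p₁ q₀ q₁ hp hq).prodMap isProperMap_id).isClosedMap.isQuotientMap
    ((continuous_kakWordPairTwo p₀ p₁ q₀ q₁ hp hq).prodMap continuous_id)
    ((kakWordPairTwo_surjective p₀ p₁ q₀ q₁ hp hq hPQ hW).prodMap Function.surjective_id)

/-- **the `U(2,2)` instance** (`P = Q = Fin 2`, planes `(0,0)` and `(1,1)`): the word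
`x ↦ κ x.1 · (hypV 0 0 t₁ · hypV 1 1 t₂, 1) · κ x.2.2` is PROPER and, for a definite second factor (`K′ ↠ U(R,S)`), ONTO —
the two `LeviKAKInput` fields at a real place of signature `(2,2)`. [cite: Knapp2002, VII §3 Thm. 7.39] -/
theorem isProperMap_and_surjective_kakWordPairTwo_fin_two (hW : Function.Surjective (UForm.kV R S)) :
    IsProperMap (fun x : DPK (Fin 2) (Fin 2) R S × (ℝ × ℝ) × DPK (Fin 2) (Fin 2) R S =>
        κ (Fin 2) (Fin 2) R S x.1 *
          ((hypV (0 : Fin 2) (0 : Fin 2) x.2.1.1 * hypV (1 : Fin 2) (1 : Fin 2) x.2.1.2 : UForm (Fin 2) (Fin 2)),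
            (1 : UForm R S)) * κ (Fin 2) (Fin 2) R S x.2.2) ∧
      Function.Surjective (fun x : DPK (Fin 2) (Fin 2) R S × (ℝ × ℝ) × DPK (Fin 2) (Fin 2) R S =>
        κ (Fin 2) (Fin 2) R S x.1 *
          ((hypV (0 : Fin 2) (0 : Fin 2) x.2.1.1 * hypV (1 : Fin 2) (1 : Fin 2) x.2.1.2 : UForm (Fin 2) (Fin 2)),
            (1 : UForm R S)) * κ (Fin 2) (Fin 2) R S x.2.2) :=
  ⟨isProperMap_kakWordPairTwo (0 : Fin 2) 1 (0 : Fin 2) 1 Fin.zero_ne_one Fin.zero_ne_one,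
    kakWordPairTwo_surjective (0 : Fin 2) 1 (0 : Fin 2) 1 Fin.zero_ne_one Fin.zero_ne_one
      (Or.inl fun a => by fin_cases a <;> simp) hW⟩

end PairTwo

end RealDualPair

end Literature.RepresentationTheory.KonnoKonno2007

end
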